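import Literature.NumberTheory.CubicFields.PureCubicLexMinProgram
import Literature.Algebra.EuclideanLattices.ShortVectorBoxFinThree
import HarnessLib

/-!
# The program `lexE`: the LLL stage and the exact unimodular transformation

Topic `NumberTheory/CubicFields`, sub-namespace `PureCubicLexMin`. List-level and matrix-level facts
about the middle stage of `perScale` (`PureCubicLexMinProgram.lean`): the rounded matrix `B̃` (a flat
list `bt` of nine integers) is fed to the tree's LLL machine as the lattice instance
`⟨3, toMat 3 3 (rowsOfFlat 3 bt)⟩`, the output rows `B̃'` come back as the flat list `lll9 bt`, and
the register expressions `uEntry i j` compute `(B̃' · adj B̃)ᵢⱼ / det B̃`. PROVED here: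

* `toMat_rowsOfFlat`, `flatOf_three`, `lll9_eq`, `list_eq_of_length_eq_nine` : reading flat lists as
  `3 × 3` matrices and back;
* `uEntry_eval` : `eval (B̃ ++ B̃') (uEntry i j) = (B̃' adj(B̃))ᵢⱼ / det B̃` (Mathlib
  `Matrix.adjugate_fin_three`, `Matrix.det_fin_three`), and `uEntry_eval_eq` (**exactness**): if
  `B̃' = U B̃` with `det B̃ ≠ 0` then the value is `Uᵢⱼ`;
* `exists_transform_of_lattice_eq` : equal lattices of two integer bases give integer matrices `U, V`
  with `L = U B̃`, `B̃ = V L`;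
* `det_ne_zero_of_approx` : nonsingularity of `B̃` from the approximation data (as inside
  `shortVectorBox_fin_three`).

## References

* H. Cohen, *A Course in Computational Algebraic Number Theory*, GTM 138 (1993), §2.7.3, §6.5. [Cohen1993]
* A. K. Lenstra, H. W. Lenstra, L. Lovász, Math. Ann. 261 (1982), Prop. 1.26. [LenstraLenstraLovasz1982]
-/

noncomputable section

namespace Literature.NumberTheory.CubicFields

namespace PureCubicLexMin

open Literature.Computability.Complexity Literature.Computability.Complexity.RegProg
  Literature.Computability.Complexity.LMat Literature.Algebra.EuclideanLattices
  Literature.Algebra.EuclideanLattices.GapCodes Matrix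

/-! ### Flat lists and `3 × 3` matrices -/

/-- Entries of the matrix of a flat row-major list. [folklore] -/
theorem toMat_rowsOfFlat (bt : List ℤ) (i j : Fin 3) :
    toMat 3 3 (rowsOfFlat 3 bt) i j = bt.getD ((i : ℕ) * 3 + j) 0 := by
  simp [rowsOfFlat, toMat_tab]

/-- The row-major flat list of a `3 × 3` lattice instance. [folklore] -/
theorem flatOf_three (L : Matrix (Fin 3) (Fin 3) ℤ) :
    SimApproxLLL.flatOf ⟨3, L⟩ = [L 0 0, L 0 1, L 0 2, L 1 0, L 1 1, L 1 2, L 2 0, L 2 1, L 2 2] := by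
  simp [SimApproxLLL.flatOf, List.ofFn_succ]
  refine ⟨?_, ?_, ?_, ?_, ?_, ?_, ?_, ?_, ?_⟩ <;> congr 1

/-- **The LLL stage as a matrix**: `lll9 bt` is the flat list of the basis `L` of
`lllOut ⟨3, toMat 3 3 (rowsOfFlat 3 bt)⟩ = ⟨3, L⟩`. [cite: LenstraLenstraLovasz1982, Prop. 1.26] -/
theorem lll9_eq (bt : List ℤ) (L : Matrix (Fin 3) (Fin 3) ℤ)
    (hL : SimApproxLLL.lllOut ⟨3, toMat 3 3 (rowsOfFlat 3 bt)⟩ = ⟨3, L⟩) :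
    lll9 bt = [L 0 0, L 0 1, L 0 2, L 1 0, L 1 1, L 1 2, L 2 0, L 2 1, L 2 2] := by
  unfold lll9
  rw [hL]
  exact flatOf_three L

/-- The LLL output instance in dimension `3` is `⟨3, its basis⟩`. [folklore] -/
theorem lllOut_three (B : Matrix (Fin 3) (Fin 3) ℤ) :
    SimApproxLLL.lllOut ⟨3, B⟩ = ⟨3, (SimApproxLLL.lllOut ⟨3, B⟩).basis⟩ := rfl

/-- A list of nine integers is the list of its nine entries. [folklore] -/
theorem list_eq_of_length_eq_nine (l : List ℤ) (h : l.length = 9) :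
    l = [l.getD 0 0, l.getD 1 0, l.getD 2 0, l.getD 3 0, l.getD 4 0, l.getD 5 0, l.getD 6 0, l.getD 7 0, l.getD 8 0] := by
  match l, h with
  | [_, _, _, _, _, _, _, _, _], _ => rfl

/-- The nine values of `btExprs` form a list of length `9`. [folklore] -/
theorem length_btExprs_map (f : Ex → ℤ) : (btExprs.map f).length = 9 := rfl

/-- **The rounded matrix as registers**: the flat list `bt` (nine entries) is the row-major list of
`toMat 3 3 (rowsOfFlat 3 bt)`. [folklore] -/
theorem eq_flat_toMat (bt : List ℤ) (h : bt.length = 9) :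
    bt = [toMat 3 3 (rowsOfFlat 3 bt) 0 0, toMat 3 3 (rowsOfFlat 3 bt) 0 1, toMat 3 3 (rowsOfFlat 3 bt) 0 2,
      toMat 3 3 (rowsOfFlat 3 bt) 1 0, toMat 3 3 (rowsOfFlat 3 bt) 1 1, toMat 3 3 (rowsOfFlat 3 bt) 1 2,
      toMat 3 3 (rowsOfFlat 3 bt) 2 0, toMat 3 3 (rowsOfFlat 3 bt) 2 1, toMat 3 3 (rowsOfFlat 3 bt) 2 2] := by
  simp only [toMat_rowsOfFlat]
  exact list_eq_of_length_eq_nine bt h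

/-! ### The exact transformation -/

/-- **Symbolic execution of `uEntry`**: on `B̃ ++ B̃'` it computes `(B̃' adj(B̃))ᵢⱼ / det B̃`.
[folklore] -/
theorem uEntry_eval (B L : Matrix (Fin 3) (Fin 3) ℤ) (i j : Fin 3) :
    Ex.eval 0 ([B 0 0, B 0 1, B 0 2, B 1 0, B 1 1, B 1 2, B 2 0, B 2 1, B 2 2] ++
      [L 0 0, L 0 1, L 0 2, L 1 0, L 1 1, L 1 2, L 2 0, L 2 1, L 2 2]) (uEntry i j) =
      (L * B.adjugate) i j / B.det := by
  rw [Matrix.mul_apply, Fin.sum_univ_three, Matrix.adjugate_fin_three, Matrix.det_fin_three]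
  fin_cases i <;> fin_cases j <;> simp [uEntry, adj3, det3, mat, Ex.eval] <;> ring_nf

/-- **Exactness of the transformation**: if `B̃' = U B̃` with `det B̃ ≠ 0` then `uEntry i j`
evaluates to `Uᵢⱼ` (`B̃' adj(B̃) = U B̃ adj(B̃) = det(B̃) U`). [cite: Cohen1993, §2.7.3] -/
theorem uEntry_eval_eq (B L U : Matrix (Fin 3) (Fin 3) ℤ) (hdet : B.det ≠ 0) (hU : L = U * B) (i j : Fin 3) :
    Ex.eval 0 ([B 0 0, B 0 1, B 0 2, B 1 0, B 1 1, B 1 2, B 2 0, B 2 1, B 2 2] ++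
      [L 0 0, L 0 1, L 0 2, L 1 0, L 1 1, L 1 2, L 2 0, L 2 1, L 2 2]) (uEntry i j) = U i j := by
  rw [uEntry_eval]
  have h : L * B.adjugate = B.det • U := by
    rw [hU, Matrix.mul_assoc, Matrix.mul_adjugate, Matrix.mul_smul, Matrix.mul_one]
  rw [h, Matrix.smul_apply, smul_eq_mul, Int.mul_ediv_cancel_left _ hdet]

/-- **Equal lattices give integer transformations both ways**: if the rows of `L` and of `B̃` span
the same `ℤ`-lattice in `ℝ³` then `L = U B̃` and `B̃ = V L` for integer matrices `U, V`. [folklore] -/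
theorem exists_transform_of_lattice_eq (B L : Matrix (Fin 3) (Fin 3) ℤ)
    (h : (⟨3, L⟩ : LatticeInstance).lattice = (⟨3, B⟩ : LatticeInstance).lattice) :
    ∃ U V : Matrix (Fin 3) (Fin 3) ℤ, L = U * B ∧ B = V * L := by
  have key : ∀ (B L : Matrix (Fin 3) (Fin 3) ℤ),
      (⟨3, L⟩ : LatticeInstance).lattice ≤ (⟨3, B⟩ : LatticeInstance).lattice →
      ∃ U : Matrix (Fin 3) (Fin 3) ℤ, L = U * B := by
    intro B L hle
    have hrow : ∀ i : Fin 3, ∃ z : Fin 3 → ℤ, z ᵥ* B = L i := by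
      intro i
      have hmem : (⟨3, L⟩ : LatticeInstance).vec i ∈ (⟨3, B⟩ : LatticeInstance).lattice :=
        hle (Submodule.subset_span (Set.mem_range_self i))
      obtain ⟨z, hz⟩ := ((⟨3, B⟩ : LatticeInstance).mem_lattice_iff _).1 hmem
      refine ⟨z, intVecToEuclidean_injective 3 ?_⟩
      exact hz
    choose U hU using hrow
    refine ⟨Matrix.of U, ?_⟩
    ext i j
    have := congr_fun (hU i) j
    rw [← this]
    rfl
  obtain ⟨U, hU⟩ := key B L h.le
  obtain ⟨V, hV⟩ := key L B h.ge
  exact ⟨U, V, hU, hV⟩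

/-- **Nonsingularity of the rounded matrix** from the approximation data: if `|Bᵢⱼ − B̃ᵢⱼ/P| ≤ δ`,
`μ ‖v‖ ≤ ‖v B‖`, `24 δ ≤ μ` and every nonzero integer row has `‖c B‖ ≥ 1/2`, then `det B̃ ≠ 0`
(a kernel vector `c` would have `‖c B̃/P‖ = 0 < (7/16)`; the perturbation bound is the hypothesis
`hC2`). [folklore] -/
theorem det_ne_zero_of_approx
    (hC2 : ∀ (B B' : Matrix (Fin 3) (Fin 3) ℝ) (δ μ : ℝ), 0 ≤ δ → 0 < μ →
      (∀ i j, |B i j - B' i j| ≤ δ) → (∀ v : Fin 3 → ℝ, μ * ‖v‖ ≤ ‖Matrix.vecMul v B‖) → 3 * δ < μ →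
      ∀ c : Fin 3 → ℤ,
        ‖Matrix.vecMul (fun i => (c i : ℝ)) B'‖ ≤ ‖Matrix.vecMul (fun i => (c i : ℝ)) B‖ * (1 + 3 * δ / μ) ∧
        ‖Matrix.vecMul (fun i => (c i : ℝ)) B‖ * (1 - 3 * δ / μ) ≤ ‖Matrix.vecMul (fun i => (c i : ℝ)) B'‖)
    (B : Matrix (Fin 3) (Fin 3) ℝ) (Bt : Matrix (Fin 3) (Fin 3) ℤ) {P δ μ : ℝ}
    (hδ : 0 ≤ δ) (hμ : 0 < μ) (h24 : 24 * δ ≤ μ)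
    (happrox : ∀ i j, |B i j - (Bt i j : ℝ) / P| ≤ δ)
    (hco : ∀ v : Fin 3 → ℝ, μ * ‖v‖ ≤ ‖v ᵥ* B‖)
    (hshort : ∀ c : Fin 3 → ℤ, c ≠ 0 → 1 / 2 ≤ ‖(fun i => (c i : ℝ)) ᵥ* B‖) : Bt.det ≠ 0 := by
  set B' : Matrix (Fin 3) (Fin 3) ℝ := Matrix.of fun i j => (Bt i j : ℝ) / P with hB'
  have happrox' : ∀ i j, |B i j - B' i j| ≤ δ := fun i j => by simpa [hB'] using happrox i j
  have h3δ : 3 * δ < μ := by linarith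
  have hlo : 7 / 8 ≤ 1 - 3 * δ / μ := by
    rw [show (7 : ℝ) / 8 = 1 - 1 / 8 by norm_num]
    refine sub_le_sub le_rfl ?_
    rw [div_le_div_iff₀ hμ (by norm_num : (0 : ℝ) < 8)]; linarith
  intro h0
  obtain ⟨c, hc0, hc⟩ := Matrix.exists_vecMul_eq_zero_iff.2 h0
  have h := (hC2 B B' δ μ hδ hμ happrox' hco h3δ c).2
  have hs := hshort c hc0
  have hz : (fun i => (c i : ℝ)) ᵥ* B' = 0 := by
    rw [hB', cast_vecMul_div, hc]
    ext i; simp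
  rw [hz, norm_zero] at h
  nlinarith [norm_nonneg ((fun i => (c i : ℝ)) ᵥ* B)]

end PureCubicLexMin

end Literature.NumberTheory.CubicFields

end
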